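import Summits.NavierStokesRegularity.NavierStokesRegularity.Theses.AxisymmetricExtremality
import Summits.NavierStokesRegularity.NavierStokesRegularity.Theorems.AxisymmetricExtremalityAxisymmetricKatoGlobalReduction
import Summits.NavierStokesRegularity.NavierStokesRegularity.Theorems.AxisymmetricExtremalityAxisymmetricKatoGlobalNoSwirlStratum

/-!
# Strategist census `s16-g4` (family `s`, gen 4, INDEPENDENT) — typed exhibits for the crux
# `AxisymmetricExtremality.AxisymmetricKatoGlobal` (stmt-NavierStokesRegularity-15453)

Companion of `STRATEGY-CENSUS-s16-g4.md`.  Every object named in the census is typed here over the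
tree's declarations and every claimed implication is kernel-checked (no `sorry`):

* §1 WEAKER INTERMEDIATE.  `ThresholdInstance` (W0) — the only slot `closes` consumes from the crux —
  with `thresholdInstance_of_crux` (crux ⇒ W0) and the re-glued deciding theorem
  `closes_of_thresholdInstance : MinimalDatumPFold → PFoldToAxisymmetric → W0 → NavierStokesRegularity`;
  `MinimalAxisymHasNoSwirl` (W0′, "an axisymmetric minimal blow-up datum is swirl free") with
  `thresholdInstance_of_minimalAxisymHasNoSwirl` (W0′ ⇒ W0 by the landed swirl-free stratum) and
  `minimalAxisymHasNoSwirl_of_thresholdInstance` (W0 ⇒ W0′, vacuously): W0′ is W0 in costume.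
* §2 DECOMPOSITION.  The swirl dichotomy at an axis singular point: `SwirlPersistsExcluded` (A) and
  `SwirlEvacuatesExcluded` (B), with the PROVED assembly
  `axisymmetricKatoGlobal_of_dichotomy : A → B → AxisymmetricKatoGlobal` (landed stubs 1, K, 2b′ of line
  `registered` handle the singular point and the off-axis case); and `AxisPointsBounded` (A ∧ B merged,
  the modulus-free a-priori statement) with `axisymmetricKatoGlobal_of_axisPointsBounded`.
* §3 STRENGTHEN.  `LocalAxisymRegularity` (S⁺_loc: Seregin's local statement — stub 2a of the line
  with the log-swirl hypothesis DELETED), typed only.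
-/

noncomputable section

open Set MeasureTheory Filter Topology Function Metric
open scoped ENNReal NNReal
open Literature.Analysis.FluidPDE Literature.Analysis.FunctionSpaces

namespace Summit.NavierStokesRegularity.NavierStokesRegularity.Cruxes.AxisymmetricKatoGlobal.StrategistS16g4

set_option linter.unusedVariables false
set_option linter.dupNamespace false


/-! ## §1 Weaker intermediates replacing the crux in `closes` -/

/-- **W0 — the threshold instance.** No axisymmetric Rusin–Šverák minimal blow-up datum exists (at
any viscosity).  This is literally what `closes` consumes from the crux slot. -/
def ThresholdInstance : Prop :=
  ∀ ν : ℝ, 0 < ν → ¬ ∃ (u₀ : (EuclideanSpace ℝ (Fin 3)) → (EuclideanSpace ℝ (Fin 3))) (g : HomSobolev (EuclideanSpace ℝ (Fin 3)) (EuclideanSpace ℂ (Fin 3)) (1 / 2 : ℝ)),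
    IsMinimalBlowupDatum ν u₀ g ∧ IsAxisymmetric u₀

/-- crux ⇒ W0 (one line: the minimality package contains `¬ HasGlobalKatoSolution`). -/
theorem thresholdInstance_of_crux (h : Theses.AxisymmetricExtremality.AxisymmetricKatoGlobal) :
    ThresholdInstance := by
  rintro ν hν ⟨u₀, g, hmin, hax⟩
  obtain ⟨hL3, hrep, hdiv, -, hnot⟩ := hmin
  exact hnot (h ν hν u₀ g hL3 hrep hdiv (fun θ x => hax θ x))

/-- **Re-glued deciding theorem**: W0 in the crux slot decides the summit (same proof as `closes`). -/
theorem closes_of_thresholdInstance (h₂ : Theses.AxisymmetricExtremality.MinimalDatumPFold)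
    (h₄ : Theses.AxisymmetricExtremality.PFoldToAxisymmetric) (h₀ : ThresholdInstance) :
    NavierStokesRegularity := by
  show Literature.NS.NavierStokesExistenceSmoothR3
  intro ν hν u₀ hsm hdiv hdec
  by_contra hno
  obtain ⟨u₁, g, hmin, hax⟩ := h₄ ν hν (h₂ ν hν ⟨u₀, hsm, hdiv, hdec, hno⟩)
  exact h₀ ν hν ⟨u₁, g, hmin, fun θ x => hax θ x⟩

/-- **W0′ — "an axisymmetric minimal blow-up datum is swirl free".** -/
def MinimalAxisymHasNoSwirl : Prop :=
  ∀ ν : ℝ, 0 < ν → ∀ (u₀ : (EuclideanSpace ℝ (Fin 3)) → (EuclideanSpace ℝ (Fin 3))) (g : HomSobolev (EuclideanSpace ℝ (Fin 3)) (EuclideanSpace ℂ (Fin 3)) (1 / 2 : ℝ)),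
    IsMinimalBlowupDatum ν u₀ g → IsAxisymmetric u₀ → HasNoSwirl u₀

/-- W0′ ⇒ W0, by the LANDED swirl-free stratum of the crux
(`axisymmetricKatoGlobal_noSwirl_stratum`: Ladyzhenskaya / Ukhovskii–Yudovich in the Kato class). -/
theorem thresholdInstance_of_minimalAxisymHasNoSwirl (h : MinimalAxisymHasNoSwirl) :
    ThresholdInstance := by
  rintro ν hν ⟨u₀, g, hmin, hax⟩
  have hsw := h ν hν u₀ g hmin hax
  obtain ⟨hL3, hrep, hdiv, -, hnot⟩ := hmin
  exact hnot (Theorems.AxisymmetricKatoGlobal.NoSwirlStratum.axisymmetricKatoGlobal_noSwirl_stratum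
    ν hν u₀ hL3 hdiv (fun θ x => hax θ x) hsw)

/-- W0 ⇒ W0′ (vacuously): so W0′ ⟺ W0 in the tree — a costume of W0, not a new intermediate. -/
theorem minimalAxisymHasNoSwirl_of_thresholdInstance (h : ThresholdInstance) :
    MinimalAxisymHasNoSwirl :=
  fun ν hν u₀ g hmin hax => (h ν hν ⟨u₀, g, hmin, hax⟩).elim

/-! ## §2 Decomposition: the swirl dichotomy at an axis singular point -/

/-- **Piece A — "swirl persists" excluded.**  An axisymmetric Kato solution on `[0,T)`, smooth on
`(0,T) × (EuclideanSpace ℝ (Fin 3))`, is bounded near `(T, x_*)` at every AXIS point `x_*` at which the swirl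
`Γ = swirl (u t)` does NOT tend to `0` as `(t, x) → (T⁻, x_*)`.  (Contains the conjectured
tornado / two-scale scenarios, Hou arXiv:2107.06509, where `Γ = O(1)` on the collapsing scale.) -/
def SwirlPersistsExcluded : Prop :=
  ∀ ν : ℝ, 0 < ν → ∀ T : ℝ, 0 < T → ∀ (u₀ : (EuclideanSpace ℝ (Fin 3)) → (EuclideanSpace ℝ (Fin 3))) (u : ℝ → (EuclideanSpace ℝ (Fin 3)) → (EuclideanSpace ℝ (Fin 3))),
    IsKatoSolutionOn T ν u₀ u → ContDiffOn ℝ (⊤ : ℕ∞) (uncurry u) (Ioo 0 T ×ˢ univ) →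
    (∀ t ∈ Ioo 0 T, IsAxisymmetric (u t)) →
    ∀ xs : (EuclideanSpace ℝ (Fin 3)), cylRadius xs = 0 →
      ¬ Tendsto (fun z : ℝ × (EuclideanSpace ℝ (Fin 3)) => swirl (u z.1) z.2) (𝓝[Iio T ×ˢ univ] (T, xs)) (𝓝 0) →
      IsBoundedNearTop u T xs

/-- **Piece B — "swirl evacuates" excluded.**  Same, at axis points where `Γ → 0` as
`(t, x) → (T⁻, x_*)` (rate-free).  Every blow-up limit there is swirl free (Γ is scale invariant),
hence — if it exists as a local-energy ancient solution with a singular point, i.e. under TYPE I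
control — impossible by the landed no-swirl endgame; the Type II case is the open content. -/
def SwirlEvacuatesExcluded : Prop :=
  ∀ ν : ℝ, 0 < ν → ∀ T : ℝ, 0 < T → ∀ (u₀ : (EuclideanSpace ℝ (Fin 3)) → (EuclideanSpace ℝ (Fin 3))) (u : ℝ → (EuclideanSpace ℝ (Fin 3)) → (EuclideanSpace ℝ (Fin 3))),
    IsKatoSolutionOn T ν u₀ u → ContDiffOn ℝ (⊤ : ℕ∞) (uncurry u) (Ioo 0 T ×ˢ univ) →
    (∀ t ∈ Ioo 0 T, IsAxisymmetric (u t)) →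
    ∀ xs : (EuclideanSpace ℝ (Fin 3)), cylRadius xs = 0 →
      Tendsto (fun z : ℝ × (EuclideanSpace ℝ (Fin 3)) => swirl (u z.1) z.2) (𝓝[Iio T ×ˢ univ] (T, xs)) (𝓝 0) →
      IsBoundedNearTop u T xs

/-- **A ∧ B merged — the modulus-free a-priori statement**: axisymmetric Kato solutions, smooth
inside, are bounded near the final time at every axis point. -/
def AxisPointsBounded : Prop :=
  ∀ ν : ℝ, 0 < ν → ∀ T : ℝ, 0 < T → ∀ (u₀ : (EuclideanSpace ℝ (Fin 3)) → (EuclideanSpace ℝ (Fin 3))) (u : ℝ → (EuclideanSpace ℝ (Fin 3)) → (EuclideanSpace ℝ (Fin 3))),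
    IsKatoSolutionOn T ν u₀ u → ContDiffOn ℝ (⊤ : ℕ∞) (uncurry u) (Ioo 0 T ×ˢ univ) →
    (∀ t ∈ Ioo 0 T, IsAxisymmetric (u t)) →
    ∀ xs : (EuclideanSpace ℝ (Fin 3)), cylRadius xs = 0 → IsBoundedNearTop u T xs

theorem axisPointsBounded_of_dichotomy (hA : SwirlPersistsExcluded) (hB : SwirlEvacuatesExcluded) :
    AxisPointsBounded := by
  intro ν hν T hT u₀ u hK hsm hax xs hxs
  by_cases hΓ : Tendsto (fun z : ℝ × (EuclideanSpace ℝ (Fin 3)) => swirl (u z.1) z.2) (𝓝[Iio T ×ˢ univ] (T, xs)) (𝓝 0)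
  · exact hB ν hν T hT u₀ u hK hsm hax xs hxs hΓ
  · exact hA ν hν T hT u₀ u hK hsm hax xs hxs hΓ

theorem dichotomy_of_axisPointsBounded (h : AxisPointsBounded) :
    SwirlPersistsExcluded ∧ SwirlEvacuatesExcluded :=
  ⟨fun ν hν T hT u₀ u hK hsm hax xs hxs _ => h ν hν T hT u₀ u hK hsm hax xs hxs,
   fun ν hν T hT u₀ u hK hsm hax xs hxs _ => h ν hν T hT u₀ u hK hsm hax xs hxs⟩

/-- **Assembly of the merged statement to the crux BY NAME** — from the LANDED stubs of line
`registered`: the singular point of a non-global axisymmetric Kato solution (stub 1,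
`stub_katoAxisymSingularPoint`), the pressure / local energy classes up to the final time (stub K,
`stub_katoLocalEnergyNearTop`) and off-axis boundedness (stub 2b′,
`stub_offAxisBounded_of_localEnergy`). -/
theorem axisymmetricKatoGlobal_of_axisPointsBounded (h : AxisPointsBounded) :
    Theses.AxisymmetricExtremality.AxisymmetricKatoGlobal := by
  intro ν hν u₀ g hL3 hrep hdiv hax
  have hax' : IsAxisymmetric u₀ := fun θ x => hax θ x
  by_contra hng
  obtain ⟨T, hT, xs, u, hK, hsm, haxi, hsing⟩ :=
    Theorems.AxisymmetricKatoGlobal.Registered.stub_katoAxisymSingularPoint ν hν u₀ hL3 hdiv hax' hng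
  have hbdd : IsBoundedNearTop u T xs := by
    by_cases h0 : cylRadius xs = 0
    · exact h ν hν T hT u₀ u hK hsm haxi xs h0
    · obtain ⟨p, hpax, hsw, hloc⟩ :=
        Theorems.AxisymmetricKatoGlobal.Registered.stub_katoLocalEnergyNearTop ν hν T hT u₀ u hK hsm haxi
      exact Theorems.AxisymmetricKatoGlobal.Registered.stub_offAxisBounded_of_localEnergy ν hν T hT u p
        hsm haxi hsw hloc xs h0
  obtain ⟨r, hr, K, hbd⟩ := hbdd
  exact absurd (hsing r hr)
    (Theorems.AxisymmetricKatoGlobal.Registered.eLpNorm_parabolicCylinder_lt_top_of_forall_le hbd).ne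

/-- **The dichotomy assembly**: `A → B → AxisymmetricKatoGlobal`, kernel-checked. -/
theorem axisymmetricKatoGlobal_of_dichotomy (hA : SwirlPersistsExcluded)
    (hB : SwirlEvacuatesExcluded) : Theses.AxisymmetricExtremality.AxisymmetricKatoGlobal :=
  axisymmetricKatoGlobal_of_axisPointsBounded (axisPointsBounded_of_dichotomy hA hB)

/-! ## §3 Strengthen: Seregin's LOCAL axisymmetric regularity statement (typed only) -/

/-- **S⁺_loc — local axisymmetric regularity** (stub 2a of line `registered` with its log-swirl
hypothesis deleted): an axially symmetric suitable weak solution of the unit-viscosity equations in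
the unit parabolic cylinder, with the printed global classes, has the origin as a regular point.
Strictly stronger than what the crux needs (no decay, no data); its only known sub-cases are the
criteria (Type I: Seregin 2020 Thm 2.1; swirl moduli: Seregin 2022 Thm 1.2, Lei–Zhang, Wei). -/
def LocalAxisymRegularity : Prop :=
  ∀ (v : ℝ → (EuclideanSpace ℝ (Fin 3)) → (EuclideanSpace ℝ (Fin 3))) (q : ℝ → (EuclideanSpace ℝ (Fin 3)) → ℝ),
    IsSuitableWeakSolutionOn (SereginSverak2009.parCylOpens 0 1) 1 0 v q →
    (∃ C : ℝ≥0, ∀ᵐ t ∂(volume.restrict (Ioo (-1 : ℝ) 0)),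
        ∫⁻ x in SereginSverak2009.spaceCyl 0 1, ‖v t x‖ₑ ^ 2 ≤ C) →
    (∃ G : ℝ → (EuclideanSpace ℝ (Fin 3)) → (EuclideanSpace ℝ (Fin 3)) →L[ℝ] (EuclideanSpace ℝ (Fin 3)),
        HasWeakSpatialGradientOn (SereginSverak2009.parCylOpens 0 1) v G ∧
        ∫⁻ z in SereginSverak2009.parCyl 0 1, ENNReal.ofReal (frobeniusNormSq (G z.1 z.2)) < ∞) →
    (∫⁻ z in SereginSverak2009.parCyl 0 1, ‖q z.1 z.2‖ₑ ^ (3 / 2 : ℝ) < ∞) →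
    (∀ t ∈ Ioo (-1 : ℝ) 0, IsAxisymmetric (v t)) →
    (∀ t ∈ Ioo (-1 : ℝ) 0, IsAxisymmetricScalar (q t)) →
    SereginSverak2009.IsRegularAtOrigin v

/-- S⁺_loc trivially implies the printed criterion of stub 2a (the named fact
`seregin2022_logSwirl_regularAtOrigin`, whose `∀`-body is stub 2a): the modulus hypothesis is
simply dropped.  (The converse direction — criterion ⇒ S⁺_loc — is the whole problem.) -/
theorem stub2a_of_localAxisymRegularity (h : LocalAxisymRegularity) :
    ∀ (v : ℝ → (EuclideanSpace ℝ (Fin 3)) → (EuclideanSpace ℝ (Fin 3))) (q : ℝ → (EuclideanSpace ℝ (Fin 3)) → ℝ),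
      IsSuitableWeakSolutionOn (SereginSverak2009.parCylOpens 0 1) 1 0 v q →
      (∃ C : ℝ≥0, ∀ᵐ t ∂(volume.restrict (Ioo (-1 : ℝ) 0)),
          ∫⁻ x in SereginSverak2009.spaceCyl 0 1, ‖v t x‖ₑ ^ 2 ≤ C) →
      (∃ G : ℝ → (EuclideanSpace ℝ (Fin 3)) → (EuclideanSpace ℝ (Fin 3)) →L[ℝ] (EuclideanSpace ℝ (Fin 3)),
          HasWeakSpatialGradientOn (SereginSverak2009.parCylOpens 0 1) v G ∧
          ∫⁻ z in SereginSverak2009.parCyl 0 1, ENNReal.ofReal (frobeniusNormSq (G z.1 z.2)) < ∞) →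
      (∫⁻ z in SereginSverak2009.parCyl 0 1, ‖q z.1 z.2‖ₑ ^ (3 / 2 : ℝ) < ∞) →
      (∀ t ∈ Ioo (-1 : ℝ) 0, IsAxisymmetric (v t)) →
      (∀ t ∈ Ioo (-1 : ℝ) 0, IsAxisymmetricScalar (q t)) →
      (∃ C₁ : ℝ, ∀ t ∈ Ioo (-1 : ℝ) 0, ∀ x ∈ SereginSverak2009.spaceCyl 0 1, 0 < cylRadius x →
          |swirl (v t) x| ≤ C₁ / Real.log (Real.exp 1 / cylRadius x) ^ 3) →
      SereginSverak2009.IsRegularAtOrigin v :=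
  fun v q h1 h2 h3 h4 h5 h6 _ => h v q h1 h2 h3 h4 h5 h6

end Summit.NavierStokesRegularity.NavierStokesRegularity.Cruxes.AxisymmetricKatoGlobal.StrategistS16g4

end
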